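import Literature.NumberTheory.Automorphic.ArchMultiWallNormalisedObjectSmooth   -- ★ p851118 (this seat): the frame (`unitaryGroupOfForm … diagonal`, `circleDiagonal_mem_archLocal_diagonal`), `secondCountableTopology_archLocal`
import Literature.MeasureTheory.Constructions.PiOptionIntegral                   -- ★ p851140 (LH10-p02 (g6)): `integral_pi_comp_piCongrLeft`, `piCongrLeft_apply_apply`, `integral_pi_of_isEmpty`
import HarnessLib

/-!
# The multi-wall invariant (diagonal frame): its literal shape, index transport along `α ≃ β`, the empty base, and the sup-norm isometries that re-bracket its variables
# (bookkeeping for the (α4-S6) induction on the number of wall places; Varadarajan 1989 §6.4, Bouaziz 1994 §3.1 (I₂), Hörmander §1.1)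

Topic `NumberTheory/Automorphic`.  THEOREMS ONLY (no `def`, no instance, no notation, no axiom, no named fact, no `sorry`); kernel lane `--kind proof --supports stmt-HodgeConjecture-24833`.
Cell `pub/hodgecm-mathlib`, crux H413 (`stmt-HodgeConjecture-24833`), line LH3 (closer stub `stub_N9`, direct road), letter L3′ organ O-L3′ (ii), (α4) «all-orders transport», stage
**(α4-S6) «MULTI-WALL base points»** (LH3-plan (g3) 2026-09-02T10:09Z; frozen invariant v4 `F0/P3c/LH10/LH10-p01/g4/s6/MultiWallInvFrozen.v4.LH10p01g4.lean`, adopted byte-for-byte by the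
(S7) consumer LH3-p01 (g5) 10:55Z).  Seat LH10-p01 (g4).  Count-neutral.
Brick (S6-B5b) part 2a.  Namespaces `Literature.Analysis.Calculus` (§1, frame-free) and `Literature.NumberTheory.Automorphic.RankOneCasimir` (§2–§3).

THE INVARIANT `InvDiag ι` (written INLINE in every statement, ★ style «functional by hypothesis»): for wall places `wl : ι → {w // IsComplex w}`, centres `z : ι → S¹` and Haar right-invariant
`ν_i` on `G_i = U(σ_{wl i} diag(2,−2))(ℂ)` (the frame of ★ (ELL-∞) at `a = (2,−2)`): for every finite-dimensional smooth slot `V`, Banach `E` (both in `Type`), jointly smooth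
`Φ : V × (ι → M₂(ℂ)) → E` vanishing off one compact `K` uniformly in `v`, compact `KV ⊆ V`, every `F` with `F (ψ, v) = (∏ 2 sin ψ_i) • ∫_{Π G_i} Φ (v, (↑↑(h_i t_{z_i}(ψ_i) h_i⁻¹))_i) d(⊗ν)`,
order `n` and sign vector `ε`: `∃ B, ∀ ψ ∈ {0 < ±ψ_i < 1}, ∀ v ∈ KV, ‖iteratedFDeriv ℝ n F (ψ, v)‖ ≤ B`.
* §1 (private plumbing) the sup-norm reindexing isometry `((β → ℝ) × V) ≃ₗᵢ ((α → ℝ) × V)` along `α ≃ β`, so jets transfer with EQUAL norms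
  (`LinearIsometryEquiv.norm_iteratedFDeriv_comp_right`).
* §2 the frame side conditions of ★ (ELL-∞) at `a = (2,−2)`, `p = q = 1`, at every complex place (`diagTwoNegTwo_frame`).
* §3 **`multiWall_transport_diag`** (`InvDiag α` at `wl ∘ e` ⇒ `InvDiag β` at `wl`; ★ `integral_pi_comp_piCongrLeft`, the dependent cast discharged through the matrix-valued function
  `b ↦ ↑↑(h_b t_b h_b⁻¹)`) and **`multiWall_base_diag`** (`IsEmpty ι`: ★ `integral_pi_of_isEmpty`, jets of `v ↦ Φ (v, ∅)` on the compact `univ × KV`).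
HONEST LABEL: HC_CM is proved only modulo the 7 printed citations (2 remaining: hLiu418 = `stmt-HodgeConjecture-24832`, h413 = `stmt-HodgeConjecture-24833`) until rung 0 closes;
bookkeeping over ★ engines, count-neutral, pays nothing by itself.

## References
* [Varadarajan1989] V. S. Varadarajan, *An Introduction to Harmonic Analysis on Semisimple Lie Groups* (1989), §6.4 Thms 22–24.
* [Bouaziz1994IntegralesOrbitales] A. Bouaziz, *Intégrales orbitales sur les groupes de Lie réductifs*, Ann. Sci. ÉNS 27 (1994), §3.1 (I₁)–(I₂) p. 579.
* [HormanderALPDO1] L. Hörmander, *The Analysis of Linear Partial Differential Operators I*, 2nd ed. (1990), §1.1 Thm. 1.1.9, §2.1.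
* [Rogawski1990] J. D. Rogawski, *Automorphic Representations of Unitary Groups in Three Variables*, Ann. of Math. Stud. 123 (1990), §8.2 pp. 119–123.
-/

set_option autoImplicit false

noncomputable section

/-! ## §1 The sup-norm reindexing isometry along `α ≃ β` (private plumbing) -/

namespace Literature.Analysis.Calculus

open _root_.Set _root_.Filter _root_.Topology
open scoped ContDiff

section Reindex

/-- Reindexing a sup-normed vector along an equivalence preserves the norm. [folklore] -/
private theorem norm_comp_equiv {α β : Type} [Fintype α] [Fintype β] (e : α ≃ β) (ψ : β → ℝ) : ‖(fun a => ψ (e a))‖ = ‖ψ‖ := by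
  refine le_antisymm ((pi_norm_le_iff_of_nonneg (norm_nonneg _)).2 fun a => norm_le_pi_norm ψ (e a))
    ((pi_norm_le_iff_of_nonneg (norm_nonneg _)).2 fun b => ?_)
  calc ‖ψ b‖ = ‖(fun a => ψ (e a)) (e.symm b)‖ := by simp only [Equiv.apply_symm_apply]
    _ ≤ ‖fun a => ψ (e a)‖ := norm_le_pi_norm (fun a => ψ (e a)) (e.symm b)

/-- **The reindexing isometry `((β → ℝ) × V) ≃ₗᵢ ((α → ℝ) × V)`, `(ψ, v) ↦ (ψ ∘ e, v)`** (sup norms). [folklore] -/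
private theorem exists_reindex_isometry {α β : Type} [Fintype α] [Fintype β] (e : α ≃ β) {V : Type} [NormedAddCommGroup V] [NormedSpace ℝ V] :
    ∃ Θ : ((β → ℝ) × V) ≃ₗᵢ[ℝ] ((α → ℝ) × V), (∀ x : (β → ℝ) × V, Θ x = (fun a => x.1 (e a), x.2)) ∧
      ∀ y : (α → ℝ) × V, Θ.symm y = (fun b => y.1 (e.symm b), y.2) := by
  refine ⟨{ toFun := fun x => (fun a => x.1 (e a), x.2)
            invFun := fun y => (fun b => y.1 (e.symm b), y.2)
            map_add' := fun x y => rfl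
            map_smul' := fun c x => rfl
            left_inv := fun x => Prod.ext (funext fun b => by simp only [Equiv.apply_symm_apply]) rfl
            right_inv := fun y => Prod.ext (funext fun a => by simp only [Equiv.symm_apply_apply]) rfl
            norm_map' := fun x => by
              show ‖((fun a => x.1 (e a)), x.2)‖ = ‖x‖
              rw [Prod.norm_def, Prod.norm_def, norm_comp_equiv] }, fun x => rfl, fun y => rfl⟩

end Reindex

end Literature.Analysis.Calculus

/-! ## §2 The frame `a = (2, −2)` at every complex place; the signed unit cube is off the walls -/

namespace Literature.NumberTheory.Automorphic.RankOneCasimir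

open _root_.Complex _root_.Matrix _root_.MeasureTheory _root_.Set _root_.Filter _root_.Topology _root_.NumberField _root_.NumberField.InfinitePlace
open _root_.Literature.NumberTheory.Automorphic _root_.Literature.NumberTheory.Automorphic.UnitaryGroup _root_.Literature.Analysis.Calculus
open scoped Matrix.Norms.Operator MatrixGroups ComplexConjugate ContDiff Real

section Frame

variable (L : Type) [Field L] [NumberField L]

/-- The side conditions of ★ (ELL-∞) in the frame `a = (2, −2)`, `p = q = 1`, at ANY complex place `w` (`σ_w 2 = 2`). [cite: Rogawski1990, §8.2 p. 122] -/
theorem diagTwoNegTwo_frame (w : {w : InfinitePlace L // IsComplex w}) :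
    (∀ i, (![(2 : L), -2]) i ≠ 0) ∧ (∀ i, (w.1.embedding ((![(2 : L), -2]) i)).im = 0) ∧
      (w.1.embedding ((![(2 : L), -2]) 0)).re * (w.1.embedding ((![(2 : L), -2]) 1)).re < 0 ∧ (1 : ℝ) * 1 = 1 ∧
      ((1 : ℝ) : ℂ) ^ 2 * w.1.embedding ((![(2 : L), -2]) 1) = -w.1.embedding ((![(2 : L), -2]) 0) := by
  -- adapted from ★ `ArchRankOneCasimirLadderCayley` (private `cayleyDiag_frame`)
  have h0 : w.1.embedding ((![(2 : L), -2]) 0) = 2 := by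
    rw [show (![(2 : L), -2]) 0 = 2 from rfl, map_ofNat]
  have h1 : w.1.embedding ((![(2 : L), -2]) 1) = -2 := by
    rw [show (![(2 : L), -2]) 1 = -2 from rfl, map_neg, map_ofNat]
  refine ⟨fun i => ?_, fun i => ?_, ?_, one_mul 1, ?_⟩
  · fin_cases i
    · exact two_ne_zero
    · exact neg_ne_zero.2 two_ne_zero
  · fin_cases i
    · show (w.1.embedding ((![(2 : L), -2]) 0)).im = 0
      rw [h0]; norm_num
    · show (w.1.embedding ((![(2 : L), -2]) 1)).im = 0
      rw [h1]; norm_num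
  · rw [h0, h1]; norm_num
  · rw [h0, h1]; norm_num

end Frame

/-! ## §3 Index transport along `α ≃ β` and the empty base -/

section Transport

variable (L : Type) [Field L]

/-- **INDEX TRANSPORT OF THE INVARIANT.**  If the invariant holds for the index type `α` at the places `wl ∘ e` (`e : α ≃ β`), it holds for `β` at `wl`: reindex the family
(`Φ_α (v, Y) = Φ (v, Y ∘ e⁻¹)`), the product (`Fintype.prod_equiv`) and the product integral (★ `integral_pi_comp_piCongrLeft` + `piCongrLeft_apply_apply`, the dependent cast discharged
through the matrix-valued function `b ↦ ↑↑(h_b t_b h_b⁻¹)`), and pull the jets back along the sup-norm isometry `(ψ, v) ↦ (ψ ∘ e, v)`. [cite: HormanderALPDO1, §1.1] -/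
theorem multiWall_transport_diag {α β : Type} [Fintype α] [Fintype β] (e : α ≃ β) (wl : β → {w : InfinitePlace L // IsComplex w}) (z : β → Circle)
    [∀ b, MeasurableSpace (unitaryGroupOfForm (starRingEnd ℂ) ((Matrix.diagonal ![(2 : L), -2]).map (wl b).1.embedding))] [∀ b, BorelSpace (unitaryGroupOfForm (starRingEnd ℂ) ((Matrix.diagonal ![(2 : L), -2]).map (wl b).1.embedding))]
    (ν : ∀ b, Measure (unitaryGroupOfForm (starRingEnd ℂ) ((Matrix.diagonal ![(2 : L), -2]).map (wl b).1.embedding))) [∀ b, (ν b).IsHaarMeasure] [∀ b, (ν b).IsMulRightInvariant]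
    (hInv : ∀ (V : Type) [NormedAddCommGroup V] [NormedSpace ℝ V] [FiniteDimensional ℝ V] (E : Type) [NormedAddCommGroup E] [NormedSpace ℝ E] [CompleteSpace E]
      (Φ : V × (α → Matrix (Fin 2) (Fin 2) ℂ) → E) (_hΦ : ContDiff ℝ ∞ Φ) (KV : Set V) (_hKV : IsCompact KV)
      (K : Set (α → Matrix (Fin 2) (Fin 2) ℂ)) (_hK : IsCompact K) (_h0 : ∀ (v : V) (Y : α → Matrix (Fin 2) (Fin 2) ℂ), Y ∉ K → Φ (v, Y) = 0)
      (F : (α → ℝ) × V → E) (_hF : ∀ x : (α → ℝ) × V, F x = (∏ a, 2 * Real.sin (x.1 a)) •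
        ∫ h : (∀ a : α, unitaryGroupOfForm (starRingEnd ℂ) ((Matrix.diagonal ![(2 : L), -2]).map (wl (e a)).1.embedding)), Φ (x.2, fun a => (((h a * ⟨circleDiagonal 2 ![z (e a) * Circle.exp (x.1 a), z (e a) * Circle.exp (-(x.1 a))], circleDiagonal_mem_archLocal_diagonal L 2 ![(2 : L), -2] (wl (e a)) _⟩ * (h a)⁻¹ : unitaryGroupOfForm (starRingEnd ℂ) ((Matrix.diagonal ![(2 : L), -2]).map (wl (e a)).1.embedding)) : GL (Fin 2) ℂ) : Matrix (Fin 2) (Fin 2) ℂ)) ∂(Measure.pi fun a => ν (e a)))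
      (n : ℕ) (ε : α → Bool),
      ∃ B : ℝ, ∀ ψ : α → ℝ, (∀ a, 0 < (if ε a then ψ a else -ψ a) ∧ (if ε a then ψ a else -ψ a) < 1) → ∀ v ∈ KV, ‖iteratedFDeriv ℝ n F (ψ, v)‖ ≤ B) :
    ∀ (V : Type) [NormedAddCommGroup V] [NormedSpace ℝ V] [FiniteDimensional ℝ V] (E : Type) [NormedAddCommGroup E] [NormedSpace ℝ E] [CompleteSpace E]
      (Φ : V × (β → Matrix (Fin 2) (Fin 2) ℂ) → E) (_hΦ : ContDiff ℝ ∞ Φ) (KV : Set V) (_hKV : IsCompact KV)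
      (K : Set (β → Matrix (Fin 2) (Fin 2) ℂ)) (_hK : IsCompact K) (_h0 : ∀ (v : V) (Y : β → Matrix (Fin 2) (Fin 2) ℂ), Y ∉ K → Φ (v, Y) = 0)
      (F : (β → ℝ) × V → E) (_hF : ∀ x : (β → ℝ) × V, F x = (∏ b, 2 * Real.sin (x.1 b)) •
        ∫ h : (∀ b : β, unitaryGroupOfForm (starRingEnd ℂ) ((Matrix.diagonal ![(2 : L), -2]).map (wl b).1.embedding)), Φ (x.2, fun b => (((h b * ⟨circleDiagonal 2 ![z b * Circle.exp (x.1 b), z b * Circle.exp (-(x.1 b))], circleDiagonal_mem_archLocal_diagonal L 2 ![(2 : L), -2] (wl b) _⟩ * (h b)⁻¹ : unitaryGroupOfForm (starRingEnd ℂ) ((Matrix.diagonal ![(2 : L), -2]).map (wl b).1.embedding)) : GL (Fin 2) ℂ) : Matrix (Fin 2) (Fin 2) ℂ)) ∂(Measure.pi ν))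
      (n : ℕ) (ε : β → Bool),
      ∃ B : ℝ, ∀ ψ : β → ℝ, (∀ b, 0 < (if ε b then ψ b else -ψ b) ∧ (if ε b then ψ b else -ψ b) < 1) → ∀ v ∈ KV, ‖iteratedFDeriv ℝ n F (ψ, v)‖ ≤ B := by
  intro V _ _ _ E _ _ _ Φ hΦ KV hKV K hK h0 F hF n ε
  haveI : ∀ b, SecondCountableTopology (unitaryGroupOfForm (starRingEnd ℂ) ((Matrix.diagonal ![(2 : L), -2]).map (wl b).1.embedding)) := fun b => secondCountableTopology_archLocal L 2 (Matrix.diagonal ![(2 : L), -2]) (wl b)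
  haveI : ∀ b, LocallyCompactSpace (unitaryGroupOfForm (starRingEnd ℂ) ((Matrix.diagonal ![(2 : L), -2]).map (wl b).1.embedding)) := fun b => locallyCompactSpace_archLocal L 2 (Matrix.diagonal ![(2 : L), -2]) (wl b)
  -- the reindexed data
  obtain ⟨Φα, hΦα⟩ : ∃ Φα : V × (α → Matrix (Fin 2) (Fin 2) ℂ) → E, ∀ p, Φα p = Φ (p.1, fun b => p.2 (e.symm b)) := ⟨_, fun _ => rfl⟩
  have hΦαd : ContDiff ℝ ∞ Φα := by
    rw [show Φα = fun p => Φ (p.1, fun b => p.2 (e.symm b)) from funext hΦα]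
    exact hΦ.comp (contDiff_fst.prodMk (contDiff_pi.2 fun b => (contDiff_apply ℝ (Matrix (Fin 2) (Fin 2) ℂ) (e.symm b)).comp contDiff_snd))
  have hKα : IsCompact ((fun Y : β → Matrix (Fin 2) (Fin 2) ℂ => fun a => Y (e a)) '' K) := hK.image (continuous_pi fun a => continuous_apply (e a))
  have h0α : ∀ (v : V) (Yα : α → Matrix (Fin 2) (Fin 2) ℂ), Yα ∉ (fun Y : β → Matrix (Fin 2) (Fin 2) ℂ => fun a => Y (e a)) '' K → Φα (v, Yα) = 0 := by
    intro v Yα hY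
    rw [hΦα]
    refine h0 _ _ fun hW => hY ⟨_, hW, ?_⟩
    funext a
    simp only [Equiv.symm_apply_apply]
  obtain ⟨Fα, hFαdef⟩ : ∃ Fα : (α → ℝ) × V → E, ∀ x, Fα x = F (fun b => x.1 (e.symm b), x.2) := ⟨_, fun _ => rfl⟩
  have hFα : ∀ x : (α → ℝ) × V, Fα x = (∏ a, 2 * Real.sin (x.1 a)) •
      ∫ h : (∀ a : α, unitaryGroupOfForm (starRingEnd ℂ) ((Matrix.diagonal ![(2 : L), -2]).map (wl (e a)).1.embedding)), Φα (x.2, fun a => (((h a * ⟨circleDiagonal 2 ![z (e a) * Circle.exp (x.1 a), z (e a) * Circle.exp (-(x.1 a))], circleDiagonal_mem_archLocal_diagonal L 2 ![(2 : L), -2] (wl (e a)) _⟩ * (h a)⁻¹ : unitaryGroupOfForm (starRingEnd ℂ) ((Matrix.diagonal ![(2 : L), -2]).map (wl (e a)).1.embedding)) : GL (Fin 2) ℂ) : Matrix (Fin 2) (Fin 2) ℂ)) ∂(Measure.pi fun a => ν (e a)) := by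
    intro x
    rw [hFαdef, hF]
    show (∏ b, 2 * Real.sin (x.1 (e.symm b))) • ∫ h : (∀ b : β, unitaryGroupOfForm (starRingEnd ℂ) ((Matrix.diagonal ![(2 : L), -2]).map (wl b).1.embedding)), Φ (x.2, fun b => (((h b * ⟨circleDiagonal 2 ![z b * Circle.exp (x.1 (e.symm b)), z b * Circle.exp (-(x.1 (e.symm b)))], circleDiagonal_mem_archLocal_diagonal L 2 ![(2 : L), -2] (wl b) _⟩ * (h b)⁻¹ : unitaryGroupOfForm (starRingEnd ℂ) ((Matrix.diagonal ![(2 : L), -2]).map (wl b).1.embedding)) : GL (Fin 2) ℂ) : Matrix (Fin 2) (Fin 2) ℂ)) ∂(Measure.pi ν) = _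
    rw [Fintype.prod_equiv e.symm (fun b => 2 * Real.sin (x.1 (e.symm b))) (fun a => 2 * Real.sin (x.1 a)) fun b => rfl,
      Literature.MeasureTheory.Constructions.integral_pi_comp_piCongrLeft ν e]
    congr 1
    refine integral_congr_ae (Eventually.of_forall fun y => ?_)
    dsimp only
    rw [hΦα]
    show Φ (x.2, fun b => (((MeasurableEquiv.piCongrLeft (fun b => unitaryGroupOfForm (starRingEnd ℂ) ((Matrix.diagonal ![(2 : L), -2]).map (wl b).1.embedding)) e y b * ⟨circleDiagonal 2 ![z b * Circle.exp (x.1 (e.symm b)), z b * Circle.exp (-(x.1 (e.symm b)))], circleDiagonal_mem_archLocal_diagonal L 2 ![(2 : L), -2] (wl b) _⟩ * (MeasurableEquiv.piCongrLeft (fun b => unitaryGroupOfForm (starRingEnd ℂ) ((Matrix.diagonal ![(2 : L), -2]).map (wl b).1.embedding)) e y b)⁻¹ : unitaryGroupOfForm (starRingEnd ℂ) ((Matrix.diagonal ![(2 : L), -2]).map (wl b).1.embedding)) : GL (Fin 2) ℂ) : Matrix (Fin 2) (Fin 2) ℂ)) =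
      Φ (x.2, fun b => (((y (e.symm b) * ⟨circleDiagonal 2 ![z (e (e.symm b)) * Circle.exp (x.1 (e.symm b)), z (e (e.symm b)) * Circle.exp (-(x.1 (e.symm b)))], circleDiagonal_mem_archLocal_diagonal L 2 ![(2 : L), -2] (wl (e (e.symm b))) _⟩ * (y (e.symm b))⁻¹ : unitaryGroupOfForm (starRingEnd ℂ) ((Matrix.diagonal ![(2 : L), -2]).map (wl (e (e.symm b))).1.embedding)) : GL (Fin 2) ℂ) : Matrix (Fin 2) (Fin 2) ℂ))
    congr 1
    refine congrArg (Prod.mk x.2) (funext fun b => ?_)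
    obtain ⟨C, hC⟩ : ∃ C : β → Matrix (Fin 2) (Fin 2) ℂ, ∀ b, C b = (((MeasurableEquiv.piCongrLeft (fun b => unitaryGroupOfForm (starRingEnd ℂ) ((Matrix.diagonal ![(2 : L), -2]).map (wl b).1.embedding)) e y b * ⟨circleDiagonal 2 ![z b * Circle.exp (x.1 (e.symm b)), z b * Circle.exp (-(x.1 (e.symm b)))], circleDiagonal_mem_archLocal_diagonal L 2 ![(2 : L), -2] (wl b) _⟩ * (MeasurableEquiv.piCongrLeft (fun b => unitaryGroupOfForm (starRingEnd ℂ) ((Matrix.diagonal ![(2 : L), -2]).map (wl b).1.embedding)) e y b)⁻¹ : unitaryGroupOfForm (starRingEnd ℂ) ((Matrix.diagonal ![(2 : L), -2]).map (wl b).1.embedding)) : GL (Fin 2) ℂ) : Matrix (Fin 2) (Fin 2) ℂ) := ⟨_, fun _ => rfl⟩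
    calc (((MeasurableEquiv.piCongrLeft (fun b => unitaryGroupOfForm (starRingEnd ℂ) ((Matrix.diagonal ![(2 : L), -2]).map (wl b).1.embedding)) e y b * ⟨circleDiagonal 2 ![z b * Circle.exp (x.1 (e.symm b)), z b * Circle.exp (-(x.1 (e.symm b)))], circleDiagonal_mem_archLocal_diagonal L 2 ![(2 : L), -2] (wl b) _⟩ * (MeasurableEquiv.piCongrLeft (fun b => unitaryGroupOfForm (starRingEnd ℂ) ((Matrix.diagonal ![(2 : L), -2]).map (wl b).1.embedding)) e y b)⁻¹ : unitaryGroupOfForm (starRingEnd ℂ) ((Matrix.diagonal ![(2 : L), -2]).map (wl b).1.embedding)) : GL (Fin 2) ℂ) : Matrix (Fin 2) (Fin 2) ℂ)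
        = C b := (hC b).symm
      _ = C (e (e.symm b)) := by rw [Equiv.apply_symm_apply]
      _ = (((MeasurableEquiv.piCongrLeft (fun b => unitaryGroupOfForm (starRingEnd ℂ) ((Matrix.diagonal ![(2 : L), -2]).map (wl b).1.embedding)) e y (e (e.symm b)) * ⟨circleDiagonal 2 ![z (e (e.symm b)) * Circle.exp (x.1 (e.symm (e (e.symm b)))), z (e (e.symm b)) * Circle.exp (-(x.1 (e.symm (e (e.symm b)))))], circleDiagonal_mem_archLocal_diagonal L 2 ![(2 : L), -2] (wl (e (e.symm b))) _⟩ * (MeasurableEquiv.piCongrLeft (fun b => unitaryGroupOfForm (starRingEnd ℂ) ((Matrix.diagonal ![(2 : L), -2]).map (wl b).1.embedding)) e y (e (e.symm b)))⁻¹ : unitaryGroupOfForm (starRingEnd ℂ) ((Matrix.diagonal ![(2 : L), -2]).map (wl (e (e.symm b))).1.embedding)) : GL (Fin 2) ℂ) : Matrix (Fin 2) (Fin 2) ℂ) := hC _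
      _ = (((y (e.symm b) * ⟨circleDiagonal 2 ![z (e (e.symm b)) * Circle.exp (x.1 (e.symm (e (e.symm b)))), z (e (e.symm b)) * Circle.exp (-(x.1 (e.symm (e (e.symm b)))))], circleDiagonal_mem_archLocal_diagonal L 2 ![(2 : L), -2] (wl (e (e.symm b))) _⟩ * (y (e.symm b))⁻¹ : unitaryGroupOfForm (starRingEnd ℂ) ((Matrix.diagonal ![(2 : L), -2]).map (wl (e (e.symm b))).1.embedding)) : GL (Fin 2) ℂ) : Matrix (Fin 2) (Fin 2) ℂ) := by
          rw [Literature.MeasureTheory.Constructions.piCongrLeft_apply_apply]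
      _ = (((y (e.symm b) * ⟨circleDiagonal 2 ![z (e (e.symm b)) * Circle.exp (x.1 (e.symm b)), z (e (e.symm b)) * Circle.exp (-(x.1 (e.symm b)))], circleDiagonal_mem_archLocal_diagonal L 2 ![(2 : L), -2] (wl (e (e.symm b))) _⟩ * (y (e.symm b))⁻¹ : unitaryGroupOfForm (starRingEnd ℂ) ((Matrix.diagonal ![(2 : L), -2]).map (wl (e (e.symm b))).1.embedding)) : GL (Fin 2) ℂ) : Matrix (Fin 2) (Fin 2) ℂ) := by rw [Equiv.symm_apply_apply]
  obtain ⟨B, hB⟩ := hInv V E Φα hΦαd KV hKV _ hKα h0α Fα hFα n fun a => ε (e a)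
  refine ⟨B, fun ψ hψ v hv => ?_⟩
  obtain ⟨Θ, hΘ, -⟩ := exists_reindex_isometry e (V := V)
  have hFΘ : F = Fα ∘ ⇑Θ := by
    funext x
    rw [Function.comp_apply, hΘ, hFαdef]
    congr 1
    exact Prod.ext (funext fun b => by simp only [Equiv.apply_symm_apply]) rfl
  rw [hFΘ, LinearIsometryEquiv.norm_iteratedFDeriv_comp_right Θ Fα (ψ, v) n, hΘ]
  exact hB _ (fun a => hψ (e a)) v hv

/-- **EMPTY BASE.**  With no wall place the object is `(ψ, v) ↦ Φ (v, ∅)` (★ `integral_pi_of_isEmpty`; empty product `= 1`), smooth, with jets bounded on the compact `univ × KV`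
(`ι → ℝ` is a one-point space). [cite: HormanderALPDO1, §1.1] -/
theorem multiWall_base_diag {ι : Type} [Fintype ι] [IsEmpty ι] (wl : ι → {w : InfinitePlace L // IsComplex w}) (z : ι → Circle)
    [∀ i, MeasurableSpace (unitaryGroupOfForm (starRingEnd ℂ) ((Matrix.diagonal ![(2 : L), -2]).map (wl i).1.embedding))] [∀ i, BorelSpace (unitaryGroupOfForm (starRingEnd ℂ) ((Matrix.diagonal ![(2 : L), -2]).map (wl i).1.embedding))]
    (ν : ∀ i, Measure (unitaryGroupOfForm (starRingEnd ℂ) ((Matrix.diagonal ![(2 : L), -2]).map (wl i).1.embedding))) [∀ i, (ν i).IsHaarMeasure] [∀ i, (ν i).IsMulRightInvariant] :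
    ∀ (V : Type) [NormedAddCommGroup V] [NormedSpace ℝ V] [FiniteDimensional ℝ V] (E : Type) [NormedAddCommGroup E] [NormedSpace ℝ E] [CompleteSpace E]
      (Φ : V × (ι → Matrix (Fin 2) (Fin 2) ℂ) → E) (_hΦ : ContDiff ℝ ∞ Φ) (KV : Set V) (_hKV : IsCompact KV)
      (K : Set (ι → Matrix (Fin 2) (Fin 2) ℂ)) (_hK : IsCompact K) (_h0 : ∀ (v : V) (Y : ι → Matrix (Fin 2) (Fin 2) ℂ), Y ∉ K → Φ (v, Y) = 0)
      (F : (ι → ℝ) × V → E) (_hF : ∀ x : (ι → ℝ) × V, F x = (∏ i, 2 * Real.sin (x.1 i)) •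
        ∫ h : (∀ i : ι, unitaryGroupOfForm (starRingEnd ℂ) ((Matrix.diagonal ![(2 : L), -2]).map (wl i).1.embedding)), Φ (x.2, fun i => (((h i * ⟨circleDiagonal 2 ![z i * Circle.exp (x.1 i), z i * Circle.exp (-(x.1 i))], circleDiagonal_mem_archLocal_diagonal L 2 ![(2 : L), -2] (wl i) _⟩ * (h i)⁻¹ : unitaryGroupOfForm (starRingEnd ℂ) ((Matrix.diagonal ![(2 : L), -2]).map (wl i).1.embedding)) : GL (Fin 2) ℂ) : Matrix (Fin 2) (Fin 2) ℂ)) ∂(Measure.pi ν))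
      (n : ℕ) (ε : ι → Bool),
      ∃ B : ℝ, ∀ ψ : ι → ℝ, (∀ i, 0 < (if ε i then ψ i else -ψ i) ∧ (if ε i then ψ i else -ψ i) < 1) → ∀ v ∈ KV, ‖iteratedFDeriv ℝ n F (ψ, v)‖ ≤ B := by
  intro V _ _ _ E _ _ _ Φ hΦ KV hKV K hK h0 F hF n ε
  have hFeq : F = fun x => Φ (x.2, fun i => isEmptyElim i) := by
    funext x
    rw [hF, Literature.MeasureTheory.Constructions.integral_pi_of_isEmpty]
    simp only [Finset.univ_eq_empty, Finset.prod_empty, one_smul]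
    exact congrArg (fun W => Φ (x.2, W)) (funext fun i => isEmptyElim i)
  have hsmooth : ContDiff ℝ ∞ F := by
    rw [hFeq]
    exact hΦ.comp (contDiff_snd.prodMk contDiff_const)
  obtain ⟨B, hB⟩ := ((Set.subsingleton_univ (α := ι → ℝ)).isCompact.prod hKV).exists_bound_of_continuousOn
    ((hsmooth.continuous_iteratedFDeriv (m := n) (by exact_mod_cast le_top)).continuousOn)
  exact ⟨B, fun ψ _ v hv => hB (ψ, v) ⟨Set.mem_univ _, hv⟩⟩

end Transport

end Literature.NumberTheory.Automorphic.RankOneCasimir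

end
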